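import Mathlib.Analysis.Matrix.HermitianFunctionalCalculus
import Mathlib.Analysis.Convex.Jensen
import HarnessLib

/-!
# Peierls–Jensen and the (strong) convexity of trace functions `X ↦ Tr f(X)`

Topic `Analysis/Matrix`. For a Hermitian matrix `X` over `𝕜 = ℝ` or `ℂ` (`RCLike 𝕜`) and a real
function `f` convex on a convex set `D ⊇ spec X`, everything PROVED (no definition, no named fact):

* **Peierls–Jensen inequality in an arbitrary orthonormal basis** (`peierls_jensen`,
  `sum_peierls_jensen_le`): for every unitary `U` and every `i`,
  `f(Re (Uᴴ X U)ᵢᵢ) ≤ Re (Uᴴ f(X) U)ᵢᵢ`, hence `Σᵢ f(Re (Uᴴ X U)ᵢᵢ) ≤ Re Tr f(X)`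
  (`f(X)` is Mathlib's `cfc f X`). This is Jensen's inequality for the spectral measure of `X` in the
  vector state of the `i`-th column of `U` [cite: Israel1979, Lemma I.3.1 (the case `f = exp`)].
* **convexity of the trace function** (`re_trace_cfc_convex_le`): for Hermitian `X`, `Y` with
  spectra in `D`, `0 ≤ t ≤ 1` and `M = tX + (1-t)Y`,
  `Re Tr f(M) ≤ t Re Tr f(X) + (1-t) Re Tr f(Y)`, by the eigenbasis-of-`M` technique of
  [cite: Israel1979, Lemma I.3.3 and its proof] (there for `exp` with Hölder; here Jensen);
  the concave mirror `re_trace_cfc_concave_ge`.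
* **strong convexity transfer** (`re_trace_cfc_convex_gap`): if moreover `x ↦ f x - (m/2)x²` is
  convex on `D`, then `t Re Tr f(X) + (1-t) Re Tr f(Y) - Re Tr f(M) ≥ (m/2) t (1-t) Re Tr (X-Y)²`
  (apply the previous item to `f - (m/2)x²` and use `t Tr X² + (1-t) Tr Y² - Tr M² = t(1-t) Tr (X-Y)²`);
  concave mirror `re_trace_cfc_concave_gap`.
* bookkeeping: `re_trace_cfc_eq_sum_eigenvalues` (`Re Tr f(X) = Σₖ f(λₖ)`),
  `re_trace_mul_self_eq_sum_sq`, `sum_eigenvalues_comp_eq_of_charpoly_eq` and the unitary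
  invariance `re_trace_cfc_unitary_conj` (`Re Tr f(W X Wᴴ) = Re Tr f(X)`).

These are the matrix-analysis steps of the quantitative Kennedy–Lieb chessboard bound
(`MathematicalPhysics/QuantumLattice/FalicovKimballChessboardGap.lean`).

References: R. B. Israel, *Convexity in the Theory of Lattice Gases*, Princeton (1979), Lemma I.3.1
("`e^{ρ(B)} ≤ ρ(e^B)` for any state `ρ`") and Lemma I.3.3 (convexity of `A ↦ ln tr e^A`, proved in
an orthonormal eigenbasis of `tA + (1-t)B`) [Israel1979].
-/

noncomputable section

open Matrix Finset
open scoped BigOperators ComplexOrder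

namespace Literature.Analysis.Matrix.TraceJensen

variable {𝕜 : Type*} [RCLike 𝕜] {n : Type*} [Fintype n] [DecidableEq n]

/-! ### Diagonal entries in a rotated orthonormal basis -/

omit [DecidableEq n] in
/-- `z · conj z` as a real cast: `z * star z = ‖z‖²`. [folklore] -/
private theorem tj_mul_star_self (z : 𝕜) : z * star z = ((‖z‖ ^ 2 : ℝ) : 𝕜) := by
  rw [RCLike.star_def, RCLike.mul_conj]
  norm_cast

/-- The diagonal entries of `W diag(d) Wᴴ` are the averages `Σₖ ‖Wᵢₖ‖² dₖ`.
[cite: Israel1979, proof of Lemma I.3.3] -/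
theorem re_conj_diagonal_apply_self (W : Matrix n n 𝕜) (d : n → ℝ) (i : n) :
    RCLike.re ((W * diagonal (fun k => (d k : 𝕜)) * Wᴴ) i i) = ∑ k, ‖W i k‖ ^ 2 * d k := by
  rw [mul_apply, map_sum]
  refine sum_congr rfl fun k _ => ?_
  rw [mul_diagonal, conjTranspose_apply, mul_right_comm, tj_mul_star_self]
  norm_cast

/-- Rows of a unitary matrix have unit norm: `Σₖ ‖Wᵢₖ‖² = 1` (`W W* = I` read on the diagonal).
[cite: Bernstein2009, Def. 3.1.1 xxii) (unitary: `A*A = I`)] -/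
theorem sum_norm_sq_row_eq_one_of_mem_unitary {W : Matrix n n 𝕜}
    (hW : W ∈ unitary (Matrix n n 𝕜)) (i : n) : ∑ k, ‖W i k‖ ^ 2 = 1 := by
  have h := congrArg (fun M : Matrix n n 𝕜 => RCLike.re (M i i)) (Unitary.mul_star_self_of_mem hW)
  simp only [mul_apply, star_eq_conjTranspose, conjTranspose_apply, tj_mul_star_self, one_apply_eq,
    RCLike.one_re] at h
  rw [← h, ← RCLike.ofReal_sum, RCLike.ofReal_re]

section Spectral

/-- The spectral theorem in the form `X = V diag(λ) Vᴴ` with `V` unitary and `λ` real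
(Mathlib's `Matrix.IsHermitian.spectral_theorem`). [cite: Bernstein2009, Cor. 5.4.5] -/
theorem eq_conj_diagonal {X : Matrix n n 𝕜} (hX : X.IsHermitian) :
    X = (hX.eigenvectorUnitary : Matrix n n 𝕜) * diagonal (fun k => (hX.eigenvalues k : 𝕜)) *
      (hX.eigenvectorUnitary : Matrix n n 𝕜)ᴴ := by
  conv_lhs => rw [hX.spectral_theorem, Unitary.conjStarAlgAut_apply]
  rfl

/-- The functional calculus in the eigenbasis: `f(X) = V diag(f(λ)) Vᴴ` (Mathlib's
`Matrix.IsHermitian.cfc_eq`; the matrix function of a diagonalizable matrix).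
[cite: Bernstein2009, Cor. 5.4.5 and Def. 10.5.1] -/
theorem cfc_eq_conj_diagonal {X : Matrix n n 𝕜} (hX : X.IsHermitian) (f : ℝ → ℝ) :
    cfc f X = (hX.eigenvectorUnitary : Matrix n n 𝕜) * diagonal (fun k => (f (hX.eigenvalues k) : 𝕜)) *
      (hX.eigenvectorUnitary : Matrix n n 𝕜)ᴴ := by
  rw [hX.cfc_eq, Matrix.IsHermitian.cfc, Unitary.conjStarAlgAut_apply]
  rfl

/-- `Vᴴ X V = diag(λ)` (unitary diagonalization). [cite: Bernstein2009, Cor. 5.4.5] -/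
theorem conjTranspose_mul_mul_eigenvectorUnitary {X : Matrix n n 𝕜} (hX : X.IsHermitian) :
    (hX.eigenvectorUnitary : Matrix n n 𝕜)ᴴ * X * (hX.eigenvectorUnitary : Matrix n n 𝕜) =
      diagonal (fun k => (hX.eigenvalues k : 𝕜)) := by
  have hV : (hX.eigenvectorUnitary : Matrix n n 𝕜) ∈ unitary (Matrix n n 𝕜) :=
    hX.eigenvectorUnitary.prop
  have h1 : (hX.eigenvectorUnitary : Matrix n n 𝕜)ᴴ * (hX.eigenvectorUnitary : Matrix n n 𝕜) = 1 := by
    rw [← star_eq_conjTranspose]; exact Unitary.star_mul_self_of_mem hV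
  conv_lhs => arg 1; arg 2; rw [eq_conj_diagonal hX]
  rw [show (hX.eigenvectorUnitary : Matrix n n 𝕜)ᴴ *
      ((hX.eigenvectorUnitary : Matrix n n 𝕜) * diagonal (fun k => (hX.eigenvalues k : 𝕜)) *
        (hX.eigenvectorUnitary : Matrix n n 𝕜)ᴴ) * (hX.eigenvectorUnitary : Matrix n n 𝕜) =
      ((hX.eigenvectorUnitary : Matrix n n 𝕜)ᴴ * (hX.eigenvectorUnitary : Matrix n n 𝕜)) *
        diagonal (fun k => (hX.eigenvalues k : 𝕜)) *
        ((hX.eigenvectorUnitary : Matrix n n 𝕜)ᴴ * (hX.eigenvectorUnitary : Matrix n n 𝕜)) by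
    simp only [Matrix.mul_assoc], h1, Matrix.one_mul, Matrix.mul_one]

/-- The eigenvalues as diagonal entries in the eigenbasis: `λᵢ = Re (Vᴴ X V)ᵢᵢ`.
[cite: Bernstein2009, Cor. 5.4.5] -/
theorem eigenvalues_eq_re_apply {X : Matrix n n 𝕜} (hX : X.IsHermitian) (i : n) :
    hX.eigenvalues i = RCLike.re (((hX.eigenvectorUnitary : Matrix n n 𝕜)ᴴ * X *
      (hX.eigenvectorUnitary : Matrix n n 𝕜)) i i) := by
  rw [conjTranspose_mul_mul_eigenvectorUnitary hX, diagonal_apply_eq, RCLike.ofReal_re]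

/-- A Hermitian `X` seen from an arbitrary basis `U`: `Re (Uᴴ X U)ᵢᵢ = Σₖ ‖(UᴴV)ᵢₖ‖² λₖ`
(`V` the eigenvector matrix of `X`). [cite: Israel1979, proof of Lemma I.3.3] -/
theorem re_rotate_apply_self {X : Matrix n n 𝕜} (hX : X.IsHermitian) (U : Matrix n n 𝕜)
    (i : n) :
    RCLike.re ((Uᴴ * X * U) i i) =
      ∑ k, ‖(Uᴴ * (hX.eigenvectorUnitary : Matrix n n 𝕜)) i k‖ ^ 2 * hX.eigenvalues k := by
  have h : Uᴴ * X * U = (Uᴴ * (hX.eigenvectorUnitary : Matrix n n 𝕜)) *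
      diagonal (fun k => (hX.eigenvalues k : 𝕜)) * (Uᴴ * (hX.eigenvectorUnitary : Matrix n n 𝕜))ᴴ := by
    conv_lhs => arg 1; arg 2; rw [eq_conj_diagonal hX]
    rw [conjTranspose_mul, conjTranspose_conjTranspose]
    simp only [Matrix.mul_assoc]
  rw [h, re_conj_diagonal_apply_self]

/-- `f(X)` seen from an arbitrary basis `U`: `Re (Uᴴ f(X) U)ᵢᵢ = Σₖ ‖(UᴴV)ᵢₖ‖² f(λₖ)`.
[cite: Israel1979, proof of Lemma I.3.3] -/
theorem re_rotate_cfc_apply_self {X : Matrix n n 𝕜} (hX : X.IsHermitian) (f : ℝ → ℝ)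
    (U : Matrix n n 𝕜) (i : n) :
    RCLike.re ((Uᴴ * cfc f X * U) i i) =
      ∑ k, ‖(Uᴴ * (hX.eigenvectorUnitary : Matrix n n 𝕜)) i k‖ ^ 2 * f (hX.eigenvalues k) := by
  have h : Uᴴ * cfc f X * U = (Uᴴ * (hX.eigenvectorUnitary : Matrix n n 𝕜)) *
      diagonal (fun k => (f (hX.eigenvalues k) : 𝕜)) *
        (Uᴴ * (hX.eigenvectorUnitary : Matrix n n 𝕜))ᴴ := by
    rw [cfc_eq_conj_diagonal hX f, conjTranspose_mul, conjTranspose_conjTranspose]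
    simp only [Matrix.mul_assoc]
  rw [h, re_conj_diagonal_apply_self]

/-- **`Re Tr f(X) = Σₖ f(λₖ(X))`** (the trace of a matrix function is the sum of `f` over the
eigenvalues: `tr(A^r) = Σᵢ λᵢ^r`, `tr(ln(A)) = Σᵢ ln λᵢ`). [cite: GolubMeurant2010, §11.6.1–11.6.2] -/
theorem re_trace_cfc_eq_sum_eigenvalues {X : Matrix n n 𝕜} (hX : X.IsHermitian) (f : ℝ → ℝ) :
    RCLike.re (trace (cfc f X)) = ∑ k, f (hX.eigenvalues k) := by
  have hV : (hX.eigenvectorUnitary : Matrix n n 𝕜) ∈ unitary (Matrix n n 𝕜) :=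
    hX.eigenvectorUnitary.prop
  have h1 : (hX.eigenvectorUnitary : Matrix n n 𝕜)ᴴ * (hX.eigenvectorUnitary : Matrix n n 𝕜) = 1 := by
    rw [← star_eq_conjTranspose]; exact Unitary.star_mul_self_of_mem hV
  rw [cfc_eq_conj_diagonal hX f, Matrix.mul_assoc, trace_mul_comm, Matrix.mul_assoc, h1,
    Matrix.mul_one, trace_diagonal, map_sum]
  simp only [RCLike.ofReal_re]

/-- `Re Tr X² = Σₖ λₖ(X)²` (`tr(A^r) = Σᵢ λᵢ^r`, `r = 2`). [cite: GolubMeurant2010, §11.6.1] -/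
theorem re_trace_mul_self_eq_sum_sq {X : Matrix n n 𝕜} (hX : X.IsHermitian) :
    RCLike.re (trace (X * X)) = ∑ k, hX.eigenvalues k ^ 2 := by
  have h : X * X = cfc (fun x : ℝ => x ^ 2) X := by
    rw [cfc_pow (fun x : ℝ => x) 2 X, cfc_id' ℝ X, sq]
  rw [h, re_trace_cfc_eq_sum_eigenvalues hX]

/-! ### The Peierls–Jensen inequality -/

/-- The diagonal entries of a Hermitian matrix in any orthonormal basis lie in every convex set
containing its spectrum. [cite: Israel1979, proof of Lemma I.3.3] -/
theorem re_rotate_apply_self_mem {X : Matrix n n 𝕜} (hX : X.IsHermitian) {D : Set ℝ}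
    (hDc : Convex ℝ D) (hD : ∀ k, hX.eigenvalues k ∈ D)
    {U : Matrix n n 𝕜} (hU : U ∈ unitary (Matrix n n 𝕜)) (i : n) :
    RCLike.re ((Uᴴ * X * U) i i) ∈ D := by
  rw [re_rotate_apply_self hX U i]
  have hW : Uᴴ * (hX.eigenvectorUnitary : Matrix n n 𝕜) ∈ unitary (Matrix n n 𝕜) := by
    rw [← star_eq_conjTranspose]
    exact mul_mem (Unitary.star_mem hU) hX.eigenvectorUnitary.prop
  have h := hDc.sum_mem (t := (univ : Finset n))
    (w := fun k => ‖(Uᴴ * (hX.eigenvectorUnitary : Matrix n n 𝕜)) i k‖ ^ 2)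
    (z := fun k => hX.eigenvalues k) (fun k _ => sq_nonneg _)
    (sum_norm_sq_row_eq_one_of_mem_unitary hW i) (fun k _ => hD k)
  simpa only [smul_eq_mul] using h

/-- **Peierls–Jensen inequality in an arbitrary orthonormal basis.** For Hermitian `X`, `f`
convex on a convex `D ⊇ spec X`, a unitary `U` and an index `i`:
`f(Re (Uᴴ X U)ᵢᵢ) ≤ Re (Uᴴ f(X) U)ᵢᵢ` — Jensen for the spectral measure of `X` in the vector state
of the `i`-th column of `U`. [cite: Israel1979, Lemma I.3.1] -/
theorem peierls_jensen {X : Matrix n n 𝕜} (hX : X.IsHermitian) {D : Set ℝ} {f : ℝ → ℝ}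
    (hf : ConvexOn ℝ D f)
    (hD : ∀ k, hX.eigenvalues k ∈ D) {U : Matrix n n 𝕜} (hU : U ∈ unitary (Matrix n n 𝕜)) (i : n) :
    f (RCLike.re ((Uᴴ * X * U) i i)) ≤ RCLike.re ((Uᴴ * cfc f X * U) i i) := by
  rw [re_rotate_apply_self hX U i, re_rotate_cfc_apply_self hX f U i]
  have hW : Uᴴ * (hX.eigenvectorUnitary : Matrix n n 𝕜) ∈ unitary (Matrix n n 𝕜) := by
    rw [← star_eq_conjTranspose]
    exact mul_mem (Unitary.star_mem hU) hX.eigenvectorUnitary.prop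
  have hJ := hf.map_sum_le (t := (univ : Finset n))
    (w := fun k => ‖(Uᴴ * (hX.eigenvectorUnitary : Matrix n n 𝕜)) i k‖ ^ 2)
    (p := fun k => hX.eigenvalues k) (fun k _ => sq_nonneg _)
    (sum_norm_sq_row_eq_one_of_mem_unitary hW i) (fun k _ => hD k)
  simpa only [smul_eq_mul] using hJ

/-- `Σᵢ (Uᴴ F U)ᵢᵢ = Tr F` for unitary `U` (similar matrices have the same trace).
[cite: Bernstein2009, Prop. 4.4.5 xii)] -/
theorem sum_rotate_apply_self {U : Matrix n n 𝕜} (hU : U ∈ unitary (Matrix n n 𝕜))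
    (F : Matrix n n 𝕜) : ∑ i, (Uᴴ * F * U) i i = trace F := by
  have h1 : U * Uᴴ = 1 := by
    rw [← star_eq_conjTranspose]; exact Unitary.mul_star_self_of_mem hU
  change trace (Uᴴ * F * U) = trace F
  rw [trace_mul_comm, ← Matrix.mul_assoc, h1, Matrix.one_mul]

/-- **Peierls–Jensen, summed**: `Σᵢ f(Re (Uᴴ X U)ᵢᵢ) ≤ Re Tr f(X)` for every unitary `U`.
[cite: Israel1979, Lemma I.3.1 and proof of Lemma I.3.3] -/
theorem sum_peierls_jensen_le {X : Matrix n n 𝕜} (hX : X.IsHermitian) {D : Set ℝ} {f : ℝ → ℝ}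
    (hf : ConvexOn ℝ D f)
    (hD : ∀ k, hX.eigenvalues k ∈ D) {U : Matrix n n 𝕜} (hU : U ∈ unitary (Matrix n n 𝕜)) :
    ∑ i, f (RCLike.re ((Uᴴ * X * U) i i)) ≤ RCLike.re (trace (cfc f X)) := by
  calc ∑ i, f (RCLike.re ((Uᴴ * X * U) i i)) ≤ ∑ i, RCLike.re ((Uᴴ * cfc f X * U) i i) :=
        sum_le_sum fun i _ => peierls_jensen hX hf hD hU i
    _ = RCLike.re (trace (cfc f X)) := by
        rw [← map_sum, sum_rotate_apply_self hU]

end Spectral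

/-! ### Convexity and strong convexity of trace functions -/

section Convexity

variable {X Y M : Matrix n n 𝕜}

omit [DecidableEq n] in
/-- Diagonal entries of a real combination: `Re (Uᴴ(aX + bY)U)ᵢᵢ = a Re(UᴴXU)ᵢᵢ + b Re(UᴴYU)ᵢᵢ`.
[folklore] -/
private theorem tj_re_rotate_combo (a b : ℝ) (U : Matrix n n 𝕜) (i : n) :
    RCLike.re ((Uᴴ * ((a : 𝕜) • X + (b : 𝕜) • Y) * U) i i) =
      a * RCLike.re ((Uᴴ * X * U) i i) + b * RCLike.re ((Uᴴ * Y * U) i i) := by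
  rw [Matrix.mul_add, Matrix.add_mul, Matrix.mul_smul, Matrix.smul_mul, Matrix.mul_smul,
    Matrix.smul_mul, Matrix.add_apply, Matrix.smul_apply, Matrix.smul_apply, smul_eq_mul, smul_eq_mul,
    map_add, RCLike.re_ofReal_mul, RCLike.re_ofReal_mul]

/-- **Convexity of the trace function `X ↦ Re Tr f(X)`** on Hermitian matrices with spectrum in a
convex set `D` on which `f` is convex: for `0 ≤ t ≤ 1` and `M = tX + (1-t)Y`,
`Re Tr f(M) ≤ t Re Tr f(X) + (1-t) Re Tr f(Y)`. Proof as in Israel's Lemma I.3.3: in an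
orthonormal eigenbasis `(uᵢ)` of `M`, `λᵢ(M) = t⟨uᵢ,Xuᵢ⟩ + (1-t)⟨uᵢ,Yuᵢ⟩`, convexity of `f`, then the
Peierls–Jensen inequality for `X` and for `Y` in that basis.
[cite: Israel1979, Lemma I.3.3 and its proof] -/
theorem re_trace_cfc_convex_le (hX : X.IsHermitian) (hY : Y.IsHermitian) (hM : M.IsHermitian)
    {t : ℝ} (ht0 : 0 ≤ t) (ht1 : t ≤ 1) (hMt : M = (t : 𝕜) • X + ((1 - t : ℝ) : 𝕜) • Y)
    {D : Set ℝ} {f : ℝ → ℝ} (hf : ConvexOn ℝ D f)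
    (hDX : ∀ k, hX.eigenvalues k ∈ D) (hDY : ∀ k, hY.eigenvalues k ∈ D) :
    RCLike.re (trace (cfc f M)) ≤
      t * RCLike.re (trace (cfc f X)) + (1 - t) * RCLike.re (trace (cfc f Y)) := by
  set U := (hM.eigenvectorUnitary : Matrix n n 𝕜) with hU
  have hUu : U ∈ unitary (Matrix n n 𝕜) := hM.eigenvectorUnitary.prop
  have hsplit : ∀ i, hM.eigenvalues i =
      t * RCLike.re ((Uᴴ * X * U) i i) + (1 - t) * RCLike.re ((Uᴴ * Y * U) i i) := by
    intro i
    rw [eigenvalues_eq_re_apply hM i, ← hU]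
    conv_lhs => rw [hMt]
    exact tj_re_rotate_combo t (1 - t) U i
  calc RCLike.re (trace (cfc f M)) = ∑ i, f (hM.eigenvalues i) := re_trace_cfc_eq_sum_eigenvalues hM f
    _ ≤ ∑ i, (t * f (RCLike.re ((Uᴴ * X * U) i i)) + (1 - t) * f (RCLike.re ((Uᴴ * Y * U) i i))) := by
        refine sum_le_sum fun i _ => ?_
        rw [hsplit i]
        have h := hf.2 (re_rotate_apply_self_mem hX hf.1 hDX hUu i)
          (re_rotate_apply_self_mem hY hf.1 hDY hUu i) ht0 (sub_nonneg.2 ht1) (add_sub_cancel t 1)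
        simpa only [smul_eq_mul] using h
    _ = t * ∑ i, f (RCLike.re ((Uᴴ * X * U) i i)) + (1 - t) * ∑ i, f (RCLike.re ((Uᴴ * Y * U) i i)) := by
        rw [sum_add_distrib, mul_sum, mul_sum]
    _ ≤ t * RCLike.re (trace (cfc f X)) + (1 - t) * RCLike.re (trace (cfc f Y)) :=
        add_le_add (mul_le_mul_of_nonneg_left (sum_peierls_jensen_le hX hf hDX hUu) ht0)
          (mul_le_mul_of_nonneg_left (sum_peierls_jensen_le hY hf hDY hUu) (sub_nonneg.2 ht1))

/-- **Concavity of the trace function** for concave `f`: `Re Tr f(M) ≥ t Re Tr f(X) + (1-t) Re Tr f(Y)`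
for `M = tX + (1-t)Y`. [cite: Israel1979, Lemma I.3.3 and its proof] -/
theorem re_trace_cfc_concave_ge (hX : X.IsHermitian) (hY : Y.IsHermitian) (hM : M.IsHermitian)
    {t : ℝ} (ht0 : 0 ≤ t) (ht1 : t ≤ 1) (hMt : M = (t : 𝕜) • X + ((1 - t : ℝ) : 𝕜) • Y)
    {D : Set ℝ} {f : ℝ → ℝ} (hf : ConcaveOn ℝ D f)
    (hDX : ∀ k, hX.eigenvalues k ∈ D) (hDY : ∀ k, hY.eigenvalues k ∈ D) :
    t * RCLike.re (trace (cfc f X)) + (1 - t) * RCLike.re (trace (cfc f Y)) ≤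
      RCLike.re (trace (cfc f M)) := by
  have h := re_trace_cfc_convex_le hX hY hM ht0 ht1 hMt hf.neg hDX hDY
  have e : ∀ Z : Matrix n n 𝕜, RCLike.re (trace (cfc (-f) Z)) = -RCLike.re (trace (cfc f Z)) := by
    intro Z
    rw [show (-f) = fun x => -f x from rfl, cfc_neg f Z, trace_neg, map_neg]
  rw [e, e, e] at h
  linarith

/-- `Re Tr f(Z) - (m/2) Re Tr Z² = Re Tr g(Z)` for `g = f - (m/2)x²`. [folklore] -/
private theorem tj_re_trace_cfc_sub_sq {Z : Matrix n n 𝕜} (hZ : Z.IsHermitian) (f : ℝ → ℝ)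
    (m : ℝ) :
    RCLike.re (trace (cfc (fun x => f x - m / 2 * x ^ 2) Z)) =
      RCLike.re (trace (cfc f Z)) - m / 2 * RCLike.re (trace (Z * Z)) := by
  rw [re_trace_cfc_eq_sum_eigenvalues hZ, re_trace_cfc_eq_sum_eigenvalues hZ,
    re_trace_mul_self_eq_sum_sq hZ, sum_sub_distrib, mul_sum]

omit [DecidableEq n] in
/-- `Re Tr (aX + bY)² = a² Re Tr X² + b² Re Tr Y² + 2ab Re Tr XY`. [folklore] -/
private theorem tj_re_trace_combo_sq (a b : ℝ) :
    RCLike.re (trace (((a : 𝕜) • X + (b : 𝕜) • Y) * ((a : 𝕜) • X + (b : 𝕜) • Y))) =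
      a ^ 2 * RCLike.re (trace (X * X)) + b ^ 2 * RCLike.re (trace (Y * Y)) +
        2 * a * b * RCLike.re (trace (X * Y)) := by
  have hYX : trace (Y * X) = trace (X * Y) := trace_mul_comm Y X
  simp only [Matrix.mul_add, Matrix.add_mul, Matrix.mul_smul, Matrix.smul_mul, trace_add,
    trace_smul, smul_eq_mul, map_add, hYX, RCLike.re_ofReal_mul]
  ring

omit [DecidableEq n] in
/-- `Re Tr (X - Y)² = Re Tr X² + Re Tr Y² - 2 Re Tr XY`. [folklore] -/
private theorem tj_re_trace_sub_sq :
    RCLike.re (trace ((X - Y) * (X - Y))) =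
      RCLike.re (trace (X * X)) + RCLike.re (trace (Y * Y)) - 2 * RCLike.re (trace (X * Y)) := by
  have hYX : trace (Y * X) = trace (X * Y) := trace_mul_comm Y X
  simp only [Matrix.mul_sub, Matrix.sub_mul, trace_sub, map_sub, hYX]
  ring

/-- **Strong convexity of trace functions.** If `x ↦ f x - (m/2) x²` is convex on the convex set
`D ⊇ spec X ∪ spec Y`, then for `0 ≤ t ≤ 1` and `M = tX + (1-t)Y`,
`(m/2) t (1-t) Re Tr (X-Y)² ≤ t Re Tr f(X) + (1-t) Re Tr f(Y) - Re Tr f(M)`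
(convexity of the trace function of `f - (m/2)x²`, and
`t Tr X² + (1-t) Tr Y² - Tr M² = t(1-t) Tr (X-Y)²`). [cite: Israel1979, Lemma I.3.3 and its proof] -/
theorem re_trace_cfc_convex_gap (hX : X.IsHermitian) (hY : Y.IsHermitian) (hM : M.IsHermitian)
    {t : ℝ} (ht0 : 0 ≤ t) (ht1 : t ≤ 1) (hMt : M = (t : 𝕜) • X + ((1 - t : ℝ) : 𝕜) • Y)
    {D : Set ℝ} {f : ℝ → ℝ} {m : ℝ} (hg : ConvexOn ℝ D (fun x => f x - m / 2 * x ^ 2))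
    (hDX : ∀ k, hX.eigenvalues k ∈ D) (hDY : ∀ k, hY.eigenvalues k ∈ D) :
    m / 2 * (t * (1 - t)) * RCLike.re (trace ((X - Y) * (X - Y))) ≤
      t * RCLike.re (trace (cfc f X)) + (1 - t) * RCLike.re (trace (cfc f Y)) -
        RCLike.re (trace (cfc f M)) := by
  have h := re_trace_cfc_convex_le hX hY hM ht0 ht1 hMt hg hDX hDY
  rw [tj_re_trace_cfc_sub_sq hM, tj_re_trace_cfc_sub_sq hX, tj_re_trace_cfc_sub_sq hY] at h
  have hM2 := tj_re_trace_combo_sq (X := X) (Y := Y) t (1 - t)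
  rw [← hMt] at hM2
  have hXY := tj_re_trace_sub_sq (X := X) (Y := Y)
  have key : m / 2 * (t * (1 - t)) * RCLike.re (trace ((X - Y) * (X - Y))) =
      m / 2 * (t * RCLike.re (trace (X * X)) + (1 - t) * RCLike.re (trace (Y * Y)) -
        RCLike.re (trace (M * M))) := by
    rw [hXY, hM2]; ring
  rw [key]
  linarith

/-- **Strong concavity of trace functions**: if `x ↦ f x + (m/2) x²` is concave on `D`, then
`(m/2) t (1-t) Re Tr (X-Y)² ≤ Re Tr f(M) - t Re Tr f(X) - (1-t) Re Tr f(Y)`, `M = tX + (1-t)Y`.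
[cite: Israel1979, Lemma I.3.3 and its proof] -/
theorem re_trace_cfc_concave_gap (hX : X.IsHermitian) (hY : Y.IsHermitian) (hM : M.IsHermitian)
    {t : ℝ} (ht0 : 0 ≤ t) (ht1 : t ≤ 1) (hMt : M = (t : 𝕜) • X + ((1 - t : ℝ) : 𝕜) • Y)
    {D : Set ℝ} {f : ℝ → ℝ} {m : ℝ} (hg : ConcaveOn ℝ D (fun x => f x + m / 2 * x ^ 2))
    (hDX : ∀ k, hX.eigenvalues k ∈ D) (hDY : ∀ k, hY.eigenvalues k ∈ D) :
    m / 2 * (t * (1 - t)) * RCLike.re (trace ((X - Y) * (X - Y))) ≤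
      RCLike.re (trace (cfc f M)) - t * RCLike.re (trace (cfc f X)) -
        (1 - t) * RCLike.re (trace (cfc f Y)) := by
  have hg' : ConvexOn ℝ D (fun x => (-f) x - m / 2 * x ^ 2) := by
    have h := hg.neg
    refine h.congr fun x _ => ?_
    simp only [Pi.neg_apply, neg_add]
    ring
  have h := re_trace_cfc_convex_gap hX hY hM ht0 ht1 hMt hg' hDX hDY
  have e : ∀ Z : Matrix n n 𝕜, RCLike.re (trace (cfc (-f) Z)) = -RCLike.re (trace (cfc f Z)) := by
    intro Z
    rw [show (-f) = fun x => -f x from rfl, cfc_neg f Z, trace_neg, map_neg]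
  rw [e, e, e] at h
  linarith

end Convexity

/-! ### Unitary invariance of eigenvalue sums -/

section Invariance

variable {X Y : Matrix n n 𝕜}

/-- Hermitian matrices with the same characteristic polynomial have the same multispectrum, hence
the same eigenvalue sums `Σₖ f(λₖ)` for every `f`. [cite: Bernstein2009, Prop. 4.4.5 xii)] -/
theorem sum_eigenvalues_comp_eq_of_charpoly_eq (hX : X.IsHermitian) (hY : Y.IsHermitian)
    (h : X.charpoly = Y.charpoly) (f : ℝ → ℝ) :
    ∑ k, f (hX.eigenvalues k) = ∑ k, f (hY.eigenvalues k) := by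
  have hr := congrArg Polynomial.roots h
  rw [hX.roots_charpoly_eq_eigenvalues, hY.roots_charpoly_eq_eigenvalues] at hr
  have h2 := congrArg (fun s : Multiset 𝕜 => (s.map (fun z => f (RCLike.re z))).sum) hr
  simpa only [Multiset.map_map, Function.comp_def, RCLike.ofReal_re, Finset.sum_eq_multiset_sum]
    using h2

/-- `(W X Wᴴ).charpoly = X.charpoly` for unitary `W` (similar matrices have the same characteristic
polynomial). [cite: Bernstein2009, Prop. 4.4.5 xii)] -/
theorem charpoly_unitary_conj {W : Matrix n n 𝕜} (hW : W ∈ unitary (Matrix n n 𝕜))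
    (X : Matrix n n 𝕜) :
    (W * X * Wᴴ).charpoly = X.charpoly := by
  have h1 : Wᴴ * W = 1 := by
    rw [← star_eq_conjTranspose]; exact Unitary.star_mul_self_of_mem hW
  rw [Matrix.charpoly_mul_comm (W * X) Wᴴ, ← Matrix.mul_assoc, h1, Matrix.one_mul]

omit [DecidableEq n] in
/-- `W X Wᴴ` is Hermitian when `X` is (Mathlib's `isHermitian_mul_mul_conjTranspose`).
[cite: Bernstein2009, Prop. 4.4.5 xii) (setting)] -/
theorem isHermitian_unitary_conj (hX : X.IsHermitian) (W : Matrix n n 𝕜) :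
    (W * X * Wᴴ).IsHermitian :=
  Matrix.isHermitian_mul_mul_conjTranspose W hX

/-- **Unitary invariance of trace functions**: `Re Tr f(W X Wᴴ) = Re Tr f(X)` for unitary `W`
(similar matrices have the same multispectrum). [cite: Bernstein2009, Prop. 4.4.5 xii)] -/
theorem re_trace_cfc_unitary_conj (hX : X.IsHermitian) {W : Matrix n n 𝕜}
    (hW : W ∈ unitary (Matrix n n 𝕜)) (f : ℝ → ℝ) :
    RCLike.re (trace (cfc f (W * X * Wᴴ))) = RCLike.re (trace (cfc f X)) := by
  rw [re_trace_cfc_eq_sum_eigenvalues (isHermitian_unitary_conj hX W) f,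
    re_trace_cfc_eq_sum_eigenvalues hX f]
  exact sum_eigenvalues_comp_eq_of_charpoly_eq (isHermitian_unitary_conj hX W) hX
    (charpoly_unitary_conj hW X) f

/-- Eigenvalues of `W X Wᴴ` lie in any set containing those of `X` (same multispectrum).
[cite: Bernstein2009, Prop. 4.4.5 xii)] -/
theorem eigenvalues_unitary_conj_mem (hX : X.IsHermitian) {W : Matrix n n 𝕜}
    (hW : W ∈ unitary (Matrix n n 𝕜)) {D : Set ℝ} (hD : ∀ k, hX.eigenvalues k ∈ D) (k : n) :
    (isHermitian_unitary_conj hX W).eigenvalues k ∈ D := by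
  have hr := congrArg Polynomial.roots (charpoly_unitary_conj hW X)
  rw [(isHermitian_unitary_conj hX W).roots_charpoly_eq_eigenvalues,
    hX.roots_charpoly_eq_eigenvalues] at hr
  have hmem : (RCLike.ofReal ((isHermitian_unitary_conj hX W).eigenvalues k) : 𝕜) ∈
      Multiset.map (RCLike.ofReal ∘ hX.eigenvalues) Finset.univ.val := by
    rw [← hr]
    exact Multiset.mem_map_of_mem _ (Finset.mem_univ_val k)
  obtain ⟨j, -, hj⟩ := Multiset.mem_map.1 hmem
  rw [Function.comp_apply] at hj
  have hj' : hX.eigenvalues j = (isHermitian_unitary_conj hX W).eigenvalues k := RCLike.ofReal_inj.mp hj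
  rw [← hj']
  exact hD j

end Invariance

end Literature.Analysis.Matrix.TraceJensen
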